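import Summits.CriticalPhenomena.PercolationContinuityZ3.Theorems.Transplant.SkelFrmFrom1ParamsPO
import Summits.CriticalPhenomena.PercolationContinuityZ3.Theorems.Transplant.SkelFrm1ParamsPO
import Summits.CriticalPhenomena.PercolationContinuityZ3.Theorems.Transplant.SkelNeg1ParamsO
import Summits.CriticalPhenomena.PercolationContinuityZ3.Theorems.Transplant.SkelPhiRunKitClause
import Summits.CriticalPhenomena.PercolationContinuityZ3.Theorems.Transplant.SkelNegBParamsKitS
import Summits.CriticalPhenomena.PercolationContinuityZ3.Theorems.Transplant.PlanarSkeletonFrmFromDefs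
import Summits.CriticalPhenomena.PercolationContinuityZ3.Theorems.Transplant.PlanarSkeletonFrmDefs
import Summits.CriticalPhenomena.PercolationContinuityZ3.Theorems.Transplant.SkelPhiStepIDataNS
import HarnessLib
import Summits.CriticalPhenomena.PercolationContinuityZ3.Theorems.Transplant.SkelFrmBParamsKitS
/-!
# U-WAVE PORT (RULING D-U, lead g21 2026-08-26; WAVE-U-MANIFEST v3.0 row «SkelFrmBParamsKitS» ↦ «SkelFrmFromBParamsKitS») of the tree module
# `Transplant/SkelFrmBParamsKitS` onto the carrier `PlanarSkeletonFrmFrom` (frames only, cylinders connected from width `ℓ₀` on)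

ORIGINAL TITLE: N2 (frames-only node `SamePDropOfSkeletonFrm₁`, OPEN) params column over `PlanarSkeletonFrm` — (ζ″) ledger, shape (B′) of record ((R-14)):

builds on p205010 (kernel theorem, internal audit signed; external expert review pending) — nothing in this file uses p205010; NOTHING is claimed about the
OPEN node U `SamePDropOfSkeletonFrmFrom₁` (nor U_s / the end state).  Lane `prim-bschramm`, seat `prim-bschramm-p3` gen 26; helper file
(`--supports stmt-CriticalPhenomena-4575 --as helper`).  PORT RULES r1–r4 of RULING D-U: declaration order and proof texts are those of the original,
byte-identical except (i) the carrier token `PlanarSkeletonFrm ↦ PlanarSkeletonFrmFrom` (binders, `namespace`/`end` lines, qualified names of twinned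
declarations), (ii) carrier-FREE declarations of the original (φ-level `Skelφ…` blocks and namespace-only arithmetic residents) are NOT re-declared —
this file imports the original and `export`s the twin-free residents (POLICY T / treatment (m1)); residents whose statement mentions a twinned
constant are copied, (iii) every carrier-binding declaration keeps its explicit binder `(Φ : PlanarSkeletonFrmFrom G)` in its own signature (r2).  Docstrings and citations are the original's.
-/

noncomputable section

open scoped Classical

namespace Summit.CriticalPhenomena.PercolationContinuityZ3.Theorems.Transplant

namespace PlanarSkeletonFrmFrom

namespace NegB

namespace KS

open Literature.Probability.Percolation Literature.Probability.LatticeModels SimpleGraph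
open Literature.Barriers.CriticalPhenomena (graphBall)
open SkelConc (Consts)
open BoxProdZ2 (kitK kitN kitL)
open SkelI (tanOff)
open Skelφ.StepI (DataN)
open Neg

/-! ## §1 The kit-link pair and its data (read off `D` alone) -/

section Data

/-- **The kit-link zone index with floor slot `mk`**: `M_kit := max (24·M_u + 63) mk` (p1-g11's exit table `pexXO_spec` needs `ℓ_kit ≥ 24·M_z + 64`, `n_kit ≥ 22·M_z + 58`,
both free at this index by `M < ℓ`, `M < n`). [this work] -/
def MK {V : Type} (D : Skelφ.StepI.DataNS V) (mk : ℕ) : ℕ := D.sM (max (24 * Mu D + 63) mk)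

/-- **The kit-link width** `n_kit := max (n₁ M_kit) (M_kit + 2 + ρz)` (the landed `NegPrm.nS` at the kit index, `R′`-slot `0`). [this work] -/
def nKit {V : Type} (D : Skelφ.StepI.DataNS V) (mk : ℕ) : ℕ := D.sN (max (24 * Mu D + 63) mk) (Skelφ.NegPrm.nS (D.n₁ (MK D mk)) (MK D mk) 0 (ρz D))

/-- The kit pair's shear `h_kit := D.hgt t M_kit n_kit`. [this work] -/
def hKit {V : Type} (t : V) (D : Skelφ.StepI.DataNS V) (mk : ℕ) : ℤ := D.hgt t (MK D mk) (nKit D mk)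

/-- The kit pair's half-length `ℓ_kit := D.len t M_kit n_kit`. [this work] -/
def ℓKit {V : Type} (t : V) (D : Skelφ.StepI.DataNS V) (mk : ℕ) : ℕ := D.len t (MK D mk) (nKit D mk)

/-- The kit pair's split point `v_kit := D.spl t M_kit n_kit`. [this work] -/
def vKit {V : Type} (t : V) (D : Skelφ.StepI.DataNS V) (mk : ℕ) : ℤ := D.spl t (MK D mk) (nKit D mk)

/-- **The kit-link region's fat radius** `RK := D.R (D.scale t M_kit n_kit)` (the radius of Step I″'s `regionN D t M_kit n_kit`). [this work] -/
def RK {V : Type} (t : V) (D : Skelφ.StepI.DataNS V) (mk : ℕ) : ℕ := D.R (D.scale t (MK D mk) (nKit D mk))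

/-- **The short-region graph radius of the apron kit** `Rs := max RK ρz` (holds the kit-link region AND the zone ball). [this work] -/
def Rs {V : Type} (t : V) (D : Skelφ.StepI.DataNS V) (mk : ℕ) : ℕ := max (RK t D mk) (ρz D)

/-- `M_u ≤ M_kit`, `24·M_u + 63 ≤ M_kit`, `D.M₀ ≤ M_kit`, `mk ≤ M_kit`. [folklore] -/
theorem MK_facts {V : Type} (D : Skelφ.StepI.DataNS V) (mk : ℕ) : Mu D ≤ MK D mk ∧ 24 * Mu D + 63 ≤ MK D mk ∧ D.M₀ ≤ MK D mk ∧ mk ≤ MK D mk := by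
  have h0 : max (24 * Mu D + 63) mk ≤ MK D mk := D.le_sM _
  have h1 : 24 * Mu D + 63 ≤ MK D mk := (le_max_left _ _).trans h0
  have h2 := M₀_le_Mu D
  exact ⟨by omega, h1, by omega, (le_max_right _ _).trans h0⟩

/-- **The kit width's facts**: `n₁ M_kit ≤ n_kit`, `M_kit < n_kit`, `M_kit + 2 + ρz ≤ n_kit`, `M_u + 3 ≤ n_kit` (raw-side exit room), `22·M_u + 58 ≤ n_kit` (p1's `pexXO_spec`). [folklore] -/
theorem nKit_facts {V : Type} (D : Skelφ.StepI.DataNS V) (mk : ℕ) : D.n₁ (MK D mk) ≤ nKit D mk ∧ MK D mk < nKit D mk ∧ MK D mk + 2 + ρz D ≤ nKit D mk ∧ Mu D + 3 ≤ nKit D mk ∧ 22 * Mu D + 58 ≤ nKit D mk := by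
  have h0 := Skelφ.NegPrm.floor_le_nS (D.n₁ (MK D mk)) (MK D mk) 0 (ρz D)
  have h1 := Skelφ.NegPrm.Mu_lt_nS (D.n₁ (MK D mk)) (MK D mk) 0 (ρz D)
  have h2 := (MK_facts D mk).2.1
  have h3 : Skelφ.NegPrm.nS (D.n₁ (MK D mk)) (MK D mk) 0 (ρz D) ≤ nKit D mk := D.le_sN _ _
  refine ⟨(Skelφ.NegPrm.n₁_le_nS _ _ _ _).trans h3, h1.trans_le h3, ?_, ?_, ?_⟩
  · omega
  · omega
  · omega

/-- **The kit pair IS the selected pair** at zone floor `max (24·M_u + 63) mk` and width floor `NegPrm.nS (n₁ M_kit) M_kit 0 ρz` (by `rfl`). [folklore] -/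
theorem kit_pair_eq {V : Type} (D : Skelφ.StepI.DataNS V) (mk : ℕ) :
    MK D mk = D.sM (max (24 * Mu D + 63) mk) ∧ nKit D mk = D.sN (max (24 * Mu D + 63) mk) (Skelφ.NegPrm.nS (D.n₁ (MK D mk)) (MK D mk) 0 (ρz D)) :=
  ⟨rfl, rfl⟩

/-- **The kit pair is admissible** (`D.M₀ ≤ M_kit`, `D.n₁ M_kit ≤ n_kit`) — the certificate the pair slot `Pv` carries. [folklore] -/
theorem kit_adm {V : Type} (D : Skelφ.StepI.DataNS V) (mk : ℕ) : D.M₀ ≤ (MK D mk, nKit D mk).1 ∧ D.n₁ (MK D mk, nKit D mk).1 ≤ (MK D mk, nKit D mk).2 := ⟨(MK_facts D mk).2.2.1, (nKit_facts D mk).1⟩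

/-- `RK ≤ Rs` and `ρz ≤ Rs`. [folklore] -/
theorem RK_le_Rs {V : Type} (t : V) (D : Skelφ.StepI.DataNS V) (mk : ℕ) : RK t D mk ≤ Rs t D mk ∧ ρz D ≤ Rs t D mk := ⟨le_max_left _ _, le_max_right _ _⟩

/-- `RK` is the radius of Step I″'s link region at the kit pair (by `rfl`). [folklore] -/
theorem RK_eq {V : Type} (t : V) (D : Skelφ.StepI.DataNS V) (mk : ℕ) : RK t D mk = D.R (Skelφ.pgScale (nKit D mk) (hKit t D mk) (3 * ℓKit t D mk)) := rfl

/-! ## §2 The apron integers (pure arithmetic in `Rs`, `M_u`) -/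

/-- The apron half-width `W := Rs + 1`. [this work] -/
def Wa {V : Type} (t : V) (D : Skelφ.StepI.DataNS V) (mk : ℕ) : ℕ := Rs t D mk + 1

/-- The stem length `d := Rs + 2` (`W + ℓ ≤ d` with `ℓ = 1`). [this work] -/
def da {V : Type} (t : V) (D : Skelφ.StepI.DataNS V) (mk : ℕ) : ℕ := Rs t D mk + 2

/-- The shell half-depth `ℓs := Rs + 2` (so `D_sh = 2ℓs + 2 = 2Rs + 6`). [this work] -/
def ℓsa {V : Type} (t : V) (D : Skelφ.StepI.DataNS V) (mk : ℕ) : ℕ := Rs t D mk + 2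

/-- The shell depth `D_sh := 2·Rs + 6`. [this work] -/
def Dsh {V : Type} (t : V) (D : Skelφ.StepI.DataNS V) (mk : ℕ) : ℕ := 2 * Rs t D mk + 6

/-- The column height bound `Kmax := (D_sh + W)·11` (`kq + 1 = 11`). [this work] -/
def Kmax {V : Type} (t : V) (D : Skelφ.StepI.DataNS V) (mk : ℕ) : ℕ := (Dsh t D mk + Wa t D mk) * 11

/-- The kit-centre height bound `KCmax := (D_sh + M_u + 1)·11`. [this work] -/
def KCmax {V : Type} (t : V) (D : Skelφ.StepI.DataNS V) (mk : ℕ) : ℕ := (Dsh t D mk + Mu D + 1) * 11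

/-- The tangential clamp surplus `M := Kmax + KCmax + W + Rs + 2` (`T₀ = D_sh + M` dominates both clamp floors). [this work] -/
def Ma {V : Type} (t : V) (D : Skelφ.StepI.DataNS V) (mk : ℕ) : ℕ := Kmax t D mk + KCmax t D mk + Wa t D mk + Rs t D mk + 2

/-- The tangential clamp `T₀ := D_sh + M` (`= tanOff ℓs M`). [this work] -/
def T₀a {V : Type} (t : V) (D : Skelφ.StepI.DataNS V) (mk : ℕ) : ℕ := Dsh t D mk + Ma t D mk

/-- `D_sh = 2ℓs + 2`. [folklore] -/
theorem Dsh_eq {V : Type} (t : V) (D : Skelφ.StepI.DataNS V) (mk : ℕ) : Dsh t D mk = 2 * ℓsa t D mk + 2 := by unfold Dsh ℓsa; omega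

/-- `T₀ = tanOff ℓs M`. [folklore] -/
theorem T₀a_eq {V : Type} (t : V) (D : Skelφ.StepI.DataNS V) (mk : ℕ) : T₀a t D mk = tanOff (ℓsa t D mk) (Ma t D mk) := by unfold T₀a tanOff; rw [Dsh_eq]

/-- `W + ℓ ≤ d` (`ℓ = 1`). [folklore] -/
theorem hd1_at {V : Type} (t : V) (D : Skelφ.StepI.DataNS V) (mk : ℕ) : Wa t D mk + 1 ≤ da t D mk := by unfold Wa da; omega

/-- `W + ℓ + d + 2 ≤ D_sh`. [folklore] -/
theorem hD1_at {V : Type} (t : V) (D : Skelφ.StepI.DataNS V) (mk : ℕ) : Wa t D mk + 1 + da t D mk + 2 ≤ Dsh t D mk := by unfold Wa da Dsh; omega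

/-- `ℓ + Rs + d + 3 ≤ D_sh`. [folklore] -/
theorem hD2_at {V : Type} (t : V) (D : Skelφ.StepI.DataNS V) (mk : ℕ) : 1 + Rs t D mk + da t D mk + 3 ≤ Dsh t D mk := by unfold da Dsh; omega

/-- `Rs + 1 ≤ D_sh`. [folklore] -/
theorem hDρ_at {V : Type} (t : V) (D : Skelφ.StepI.DataNS V) (mk : ℕ) : Rs t D mk + 1 ≤ Dsh t D mk := by unfold Dsh; omega

/-- `Rs + ℓ ≤ W`. [folklore] -/
theorem hW_at {V : Type} (t : V) (D : Skelφ.StepI.DataNS V) (mk : ℕ) : Rs t D mk + 1 ≤ Wa t D mk := by unfold Wa; omega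

/-- **`(D_sh + W)·(kq+1) ≤ Kmax` for every `kq ≤ 10`** (runX: `kq = 10`; face frame: factor `3`; root frame: factor `1`). [folklore] -/
theorem hKmax_at {V : Type} (t : V) (D : Skelφ.StepI.DataNS V) (mk : ℕ) {c : ℕ} (hc : c ≤ 11) : (Dsh t D mk + Wa t D mk) * c ≤ Kmax t D mk := by unfold Kmax; exact Nat.mul_le_mul_left _ hc

/-- **`(D_sh + M_u + 1)·(kq+1) ≤ KCmax` for every factor `≤ 11`**. [folklore] -/
theorem hKCmax_at {V : Type} (t : V) (D : Skelφ.StepI.DataNS V) (mk : ℕ) {c : ℕ} (hc : c ≤ 11) : (Dsh t D mk + Mu D + 1) * c ≤ KCmax t D mk := by unfold KCmax; exact Nat.mul_le_mul_left _ hc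

/-- The unit-factor forms `D_sh + W ≤ Kmax`, `D_sh + M_u + 1 ≤ KCmax` (root frame). [folklore] -/
theorem hKmax_one {V : Type} (t : V) (D : Skelφ.StepI.DataNS V) (mk : ℕ) : Dsh t D mk + Wa t D mk ≤ Kmax t D mk ∧ Dsh t D mk + Mu D + 1 ≤ KCmax t D mk := by
  constructor
  · simpa using hKmax_at t D mk (c := 1) (by norm_num)
  · simpa using hKCmax_at t D mk (c := 1) (by norm_num)

/-- **The two clamp floors**: `W + Kmax + ℓ + 1 ≤ T₀` and `D_sh + KCmax + Rs ≤ T₀` (ℤ shapes as in the clauses). [folklore] -/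
theorem hT_at {V : Type} (t : V) (D : Skelφ.StepI.DataNS V) (mk : ℕ) : (Wa t D mk : ℤ) + Kmax t D mk + 1 + 1 ≤ tanOff (ℓsa t D mk) (Ma t D mk) ∧ (Dsh t D mk : ℤ) + KCmax t D mk + Rs t D mk ≤ tanOff (ℓsa t D mk) (Ma t D mk) := by
  rw [← T₀a_eq]
  constructor
  · have : Wa t D mk + Kmax t D mk + 1 + 1 ≤ T₀a t D mk := by unfold T₀a Ma Dsh; omega
    exact_mod_cast this
  · have : Dsh t D mk + KCmax t D mk + Rs t D mk ≤ T₀a t D mk := by unfold T₀a Ma; omega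
    exact_mod_cast this

/-- `D_sh ≤ T₀`, `Rs + 2 ≤ T₀`, `1 ≤ T₀`. [folklore] -/
theorem le_T₀a {V : Type} (t : V) (D : Skelφ.StepI.DataNS V) (mk : ℕ) : Dsh t D mk ≤ T₀a t D mk ∧ Rs t D mk + 2 ≤ T₀a t D mk ∧ 1 ≤ T₀a t D mk := by unfold T₀a Dsh; omega

end Data

/-! ## §3 The constants that read the skeleton (degree bound, comparison radii) -/

section Skel

/-- **The fat-prism radius of the apron** `R'_P := cylRadMax G φ types 1 (Rs + KCmax + (W + Kmax))` (p3-g9 14:57:15Z (ii): the apron capture radius). [this work] -/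
def RPa {V : Type} {G : SimpleGraph V} [G.LocallyFinite] (Φ : PlanarSkeletonFrmFrom G) (t : V) (D : Skelφ.StepI.DataNS V) (mk : ℕ) : ℕ := Skelφ.cylRadMax G Φ.φ Φ.types 1 (Rs t D mk + KCmax t D mk + (Wa t D mk + Kmax t D mk))

/-- **The kit reach** `reach := 13·(T₀+1) + 13·d + KCmax` (quasi-step cost `N = 13`): a level-`j` kit centre sits within `j + reach` of the core. [this work] -/
def reachA {V : Type} (t : V) (D : Skelφ.StepI.DataNS V) (mk : ℕ) : ℕ := 13 * (T₀a t D mk + 1) + 13 * da t D mk + KCmax t D mk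

/-- The near/far base `base := 13·(T₀+2) + 13·d + (W + Kmax + R'_P) + (KCmax + Rs)` (`r₀ ≥ base`). [this work] -/
def baseA {V : Type} {G : SimpleGraph V} [G.LocallyFinite] (Φ : PlanarSkeletonFrmFrom G) (t : V) (D : Skelφ.StepI.DataNS V) (mk : ℕ) : ℕ := 13 * (T₀a t D mk + 2) + 13 * da t D mk + (Wa t D mk + Kmax t D mk + RPa Φ t D mk) + (KCmax t D mk + Rs t D mk)

/-- The shell radius `rs := 2·(1 + base)`. [this work] -/
def rsA {V : Type} {G : SimpleGraph V} [G.LocallyFinite] (Φ : PlanarSkeletonFrmFrom G) (t : V) (D : Skelφ.StepI.DataNS V) (mk : ℕ) : ℕ := 2 * (1 + baseA Φ t D mk)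

/-- The Step-III region-size bound `cS := 14·(T₀+1) + 14·d + (2W+1)(Kmax+1)(Δ+1)^{R'_P}`. [this work] -/
def cSA {V : Type} {G : SimpleGraph V} [G.LocallyFinite] (Φ : PlanarSkeletonFrmFrom G) (t : V) (D : Skelφ.StepI.DataNS V) (mk : ℕ) : ℕ := 14 * (T₀a t D mk + 1) + 14 * da t D mk + (2 * Wa t D mk + 1) * (Kmax t D mk + 1) * (Φ.Δ + 1) ^ RPa Φ t D mk

/-- The short-region card bound `cU := (Δ+1)^{RK}`. [this work] -/
def cUA {V : Type} {G : SimpleGraph V} [G.LocallyFinite] (Φ : PlanarSkeletonFrmFrom G) (t : V) (D : Skelφ.StepI.DataNS V) (mk : ℕ) : ℕ := (Φ.Δ + 1) ^ RK t D mk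

/-- The Step-III seed-size bound `sB := 1 + Δ·cS + cS·cU`. [this work] -/
def sBA {V : Type} {G : SimpleGraph V} [G.LocallyFinite] (Φ : PlanarSkeletonFrmFrom G) (t : V) (D : Skelφ.StepI.DataNS V) (mk : ℕ) : ℕ := 1 + Φ.Δ * cSA Φ t D mk + cSA Φ t D mk * cUA Φ t D mk

/-- The contact multiplier `B := (Δ+1)^{2·rs}`. [this work] -/
def BA {V : Type} {G : SimpleGraph V} [G.LocallyFinite] (Φ : PlanarSkeletonFrmFrom G) (t : V) (D : Skelφ.StepI.DataNS V) (mk : ℕ) : ℕ := (Φ.Δ + 1) ^ (2 * rsA Φ t D mk)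

/-- `cylRadMax G φ types 1 (Rs + KCmax + (W + Kmax)) ≤ R'_P` (by `rfl`). [folklore] -/
theorem hR'_at {V : Type} {G : SimpleGraph V} [G.LocallyFinite] (Φ : PlanarSkeletonFrmFrom G) (t : V) (D : Skelφ.StepI.DataNS V) (mk : ℕ) : Skelφ.cylRadMax G Φ.φ Φ.types 1 (Rs t D mk + KCmax t D mk + (Wa t D mk + Kmax t D mk)) ≤ RPa Φ t D mk := le_rfl

/-- `1 ≤ cU`. [folklore] -/
theorem hcU1_at {V : Type} {G : SimpleGraph V} [G.LocallyFinite] (Φ : PlanarSkeletonFrmFrom G) (t : V) (D : Skelφ.StepI.DataNS V) (mk : ℕ) : 1 ≤ cUA Φ t D mk := Nat.one_le_pow _ _ (Nat.succ_pos _)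

/-- **THE APRON PARAMETERS OF RECORD** `⟨N := 13, ℓs, M, d, W, ℓ := 1, R'_P, A, r₀⟩` — the kit-centre offset `A` is per frame (runX: `(M_u+1)·U_L + 1`; root frame:
`M_u + 2`; face frame: `(M_u+1)·pr.D + 1`) and the near/far threshold `r₀` is a late slot (`≥ base`, `≥ Rl + reach`). [cite: KozmaNitzan2024, §4 Lemma 10 (pp. 18–21)] -/
def apron {V : Type} {G : SimpleGraph V} [G.LocallyFinite] (Φ : PlanarSkeletonFrmFrom G) (t : V) (D : Skelφ.StepI.DataNS V) (mk : ℕ) (A : ℤ) (r₀ : ℕ) : Skelφ.ApronPrm := ⟨13, ℓsa t D mk, Ma t D mk, da t D mk, Wa t D mk, 1, RPa Φ t D mk, A, r₀⟩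

/-- The fields of `apron` by name (all `rfl`). [folklore] -/
theorem apron_fields {V : Type} {G : SimpleGraph V} [G.LocallyFinite] (Φ : PlanarSkeletonFrmFrom G) (t : V) (D : Skelφ.StepI.DataNS V) (mk : ℕ) (A : ℤ) (r₀ : ℕ) :
    (apron Φ t D mk A r₀).N = 13 ∧ (apron Φ t D mk A r₀).ℓs = ℓsa t D mk ∧ (apron Φ t D mk A r₀).M = Ma t D mk ∧ (apron Φ t D mk A r₀).d = da t D mk ∧
      (apron Φ t D mk A r₀).W = Wa t D mk ∧ (apron Φ t D mk A r₀).ℓ = 1 ∧ (apron Φ t D mk A r₀).R' = RPa Φ t D mk ∧ (apron Φ t D mk A r₀).A = A ∧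
      (apron Φ t D mk A r₀).r₀ = r₀ :=
  ⟨rfl, rfl, rfl, rfl, rfl, rfl, rfl, rfl, rfl⟩

/-- `shellD apron = D_sh`. [folklore] -/
theorem shellD_apron {V : Type} {G : SimpleGraph V} [G.LocallyFinite] (Φ : PlanarSkeletonFrmFrom G) (t : V) (D : Skelφ.StepI.DataNS V) (mk : ℕ) (A : ℤ) (r₀ : ℕ) : Skelφ.shellD (apron Φ t D mk A r₀) = Dsh t D mk := by
  unfold Skelφ.shellD apron; rw [Dsh_eq]

/-- `tanOff apron.ℓs apron.M = T₀`. [folklore] -/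
theorem tanOff_apron {V : Type} {G : SimpleGraph V} [G.LocallyFinite] (Φ : PlanarSkeletonFrmFrom G) (t : V) (D : Skelφ.StepI.DataNS V) (mk : ℕ) (A : ℤ) (r₀ : ℕ) : tanOff (apron Φ t D mk A r₀).ℓs (apron Φ t D mk A r₀).M = T₀a t D mk := (T₀a_eq t D mk).symm

/-- **The constant inequalities of the clauses for `apron`** (`hPN` at `13`, `hd1 hD1 hD2 hDρ hℓ hW`, `hKmax/hKCmax` at any factor `≤ 11`, `hR'`, `hT hT'`). [folklore] -/
theorem apron_ok {V : Type} {G : SimpleGraph V} [G.LocallyFinite] (Φ : PlanarSkeletonFrmFrom G) (t : V) (D : Skelφ.StepI.DataNS V) (mk : ℕ) (A : ℤ) (r₀ : ℕ) {c : ℕ} (hc : c ≤ 11) :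
    13 ≤ (apron Φ t D mk A r₀).N ∧
    (apron Φ t D mk A r₀).W + (apron Φ t D mk A r₀).ℓ ≤ (apron Φ t D mk A r₀).d ∧
    (apron Φ t D mk A r₀).W + (apron Φ t D mk A r₀).ℓ + (apron Φ t D mk A r₀).d + 2 ≤ Skelφ.shellD (apron Φ t D mk A r₀) ∧
    (apron Φ t D mk A r₀).ℓ + Rs t D mk + (apron Φ t D mk A r₀).d + 3 ≤ Skelφ.shellD (apron Φ t D mk A r₀) ∧
    Rs t D mk + 1 ≤ Skelφ.shellD (apron Φ t D mk A r₀) ∧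
    1 ≤ (apron Φ t D mk A r₀).ℓ ∧ Rs t D mk + (apron Φ t D mk A r₀).ℓ ≤ (apron Φ t D mk A r₀).W ∧
    (Skelφ.shellD (apron Φ t D mk A r₀) + (apron Φ t D mk A r₀).W) * c ≤ Kmax t D mk ∧
    (Skelφ.shellD (apron Φ t D mk A r₀) + Mu D + 1) * c ≤ KCmax t D mk ∧
    Skelφ.cylRadMax G Φ.φ Φ.types (apron Φ t D mk A r₀).ℓ (Rs t D mk + KCmax t D mk + ((apron Φ t D mk A r₀).W + Kmax t D mk)) ≤ (apron Φ t D mk A r₀).R' ∧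
    ((apron Φ t D mk A r₀).W : ℤ) + Kmax t D mk + (apron Φ t D mk A r₀).ℓ + 1 ≤ tanOff (apron Φ t D mk A r₀).ℓs (apron Φ t D mk A r₀).M ∧
    (Skelφ.shellD (apron Φ t D mk A r₀) : ℤ) + KCmax t D mk + Rs t D mk ≤ tanOff (apron Φ t D mk A r₀).ℓs (apron Φ t D mk A r₀).M := by
  rw [shellD_apron]
  simp only [apron]
  refine ⟨le_rfl, hd1_at t D mk, hD1_at t D mk, ?_, hDρ_at t D mk, le_rfl, hW_at t D mk, hKmax_at t D mk hc, hKCmax_at t D mk hc, hR'_at Φ t D mk, ?_, (hT_at t D mk).2⟩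
  · have := hD2_at t D mk; omega
  · have := (hT_at t D mk).1; push_cast at this ⊢; linarith

/-- **The size inequalities for `apron`**: `hrs` (`2(1 + 13(T₀+2) + 13d + (W+Kmax+R'_P) + (KCmax+Rs)) ≤ rs`) and `hcS`. [folklore] -/
theorem apron_sizes {V : Type} {G : SimpleGraph V} [G.LocallyFinite] (Φ : PlanarSkeletonFrmFrom G) (t : V) (D : Skelφ.StepI.DataNS V) (mk : ℕ) (A : ℤ) (r₀ : ℕ) :
    2 * (1 + (apron Φ t D mk A r₀).N * (tanOff (apron Φ t D mk A r₀).ℓs (apron Φ t D mk A r₀).M + 2) + (apron Φ t D mk A r₀).N * (apron Φ t D mk A r₀).d +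
        ((apron Φ t D mk A r₀).W + Kmax t D mk + (apron Φ t D mk A r₀).R') + (KCmax t D mk + Rs t D mk)) ≤ rsA Φ t D mk ∧
    ((apron Φ t D mk A r₀).N + 1) * (tanOff (apron Φ t D mk A r₀).ℓs (apron Φ t D mk A r₀).M + 1) + ((apron Φ t D mk A r₀).N + 1) * (apron Φ t D mk A r₀).d +
        (2 * (apron Φ t D mk A r₀).W + 1) * (Kmax t D mk + 1) * (Φ.Δ + 1) ^ (apron Φ t D mk A r₀).R' ≤ cSA Φ t D mk := by
  rw [tanOff_apron]
  simp only [apron]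
  exact ⟨by unfold rsA baseA; omega, by unfold cSA; omega⟩

/-- **`hr₀` for `apron`**: any `r₀ ≥ base` satisfies `13(T₀+2) + 13d + (W+Kmax+R'_P) + (KCmax+Rs) ≤ r₀`. [folklore] -/
theorem hr₀_apron {V : Type} {G : SimpleGraph V} [G.LocallyFinite] (Φ : PlanarSkeletonFrmFrom G) (t : V) (D : Skelφ.StepI.DataNS V) (mk : ℕ) (A : ℤ) {r₀ : ℕ} (h : baseA Φ t D mk ≤ r₀) :
    (apron Φ t D mk A r₀).N * (tanOff (apron Φ t D mk A r₀).ℓs (apron Φ t D mk A r₀).M + 2) + (apron Φ t D mk A r₀).N * (apron Φ t D mk A r₀).d +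
      ((apron Φ t D mk A r₀).W + Kmax t D mk + (apron Φ t D mk A r₀).R') + (KCmax t D mk + Rs t D mk) ≤ (apron Φ t D mk A r₀).r₀ := by
  rw [tanOff_apron]
  simp only [apron]
  unfold baseA at h; omega

/-- **`hreach` for `apron`**: any `r₀ ≥ r + reach` satisfies `r + (13(T₀+1) + 13d + KCmax) ≤ r₀`. [folklore] -/
theorem hreach_apron {V : Type} {G : SimpleGraph V} [G.LocallyFinite] (Φ : PlanarSkeletonFrmFrom G) (t : V) (D : Skelφ.StepI.DataNS V) (mk : ℕ) (A : ℤ) {r r₀ : ℕ} (h : r + reachA t D mk ≤ r₀) :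
    r + ((apron Φ t D mk A r₀).N * (tanOff (apron Φ t D mk A r₀).ℓs (apron Φ t D mk A r₀).M + 1) + (apron Φ t D mk A r₀).N * (apron Φ t D mk A r₀).d + KCmax t D mk) ≤
      (apron Φ t D mk A r₀).r₀ := by
  rw [tanOff_apron]
  simp only [apron]
  unfold reachA at h; omega

/-- **The short region of the kit at centre `c`** over a planar map `ψ` (the kit pair's own oriented map `φK`, part Slots): Step I″'s fat parallelogram
`pgramPrismFin ψ c n_kit h_kit (3ℓ_kit) RK`. [this work] -/
def RgK {V : Type} (G : SimpleGraph V) [G.LocallyFinite] (t : V) (D : Skelφ.StepI.DataNS V) (mk : ℕ) (ψ : V → Site 2) (c : V) : Finset V := Skelφ.pgramPrismFin G ψ c (nKit D mk) (hKit t D mk) (3 * ℓKit t D mk) (RK t D mk)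

/-- `RgK ψ c ⊆ B_G(c, Rs)` (`hRg`). [folklore] -/
theorem RgK_subset_graphBall {V : Type} {G : SimpleGraph V} [G.LocallyFinite] (t : V) (D : Skelφ.StepI.DataNS V) (mk : ℕ) (ψ : V → Site 2) (c : V) : ∀ u ∈ RgK G t D mk ψ c, u ∈ graphBall G c (Rs t D mk) := by
  intro u hu
  have hu' := (Skelφ.mem_pgramPrismFin G ψ).1 hu
  exact Literature.Barriers.CriticalPhenomena.graphBall_mono G c (RK_le_Rs t D mk).1 (Skelφ.cylBall_subset_prism G ψ c _ _ hu'.1).1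

/-- `|RgK ψ c| ≤ cU = (Δ+1)^{RK}` (`hRgcard`). [folklore] -/
theorem card_RgK_le {V : Type} {G : SimpleGraph V} [G.LocallyFinite] (Φ : PlanarSkeletonFrmFrom G) (t : V) (D : Skelφ.StepI.DataNS V) (mk : ℕ) (ψ : V → Site 2) (c : V) : (RgK G t D mk ψ c).card ≤ cUA Φ t D mk := by
  classical
  refine le_trans (Finset.card_le_card fun v hv => ?_)
    (Skelφ.card_cylBallFin_le (φ := ψ) Φ.degree_le c (Skelφ.pgScale (nKit D mk) (hKit t D mk) (3 * ℓKit t D mk)) (RK t D mk))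
  rw [Skelφ.mem_cylBallFin]
  exact ((Skelφ.mem_pgramPrismFin G ψ).1 hv).1

/-- **The short-piece record of the kit pair** (centre-independent data: single type): `⟨n_kit, h_kit, ℓ_kit, RK, v_kit⟩`. [this work] -/
def QK {V : Type} (t : V) (D : Skelφ.StepI.DataNS V) (mk : ℕ) : Skelφ.ShortPc V := ⟨fun _ => nKit D mk, fun _ => hKit t D mk, fun _ => ℓKit t D mk, fun _ => RK t D mk, fun _ => vKit t D mk⟩

/-- The fields of `QK` (all `rfl`) and the rooms `1 ≤ n_kit`, `M_u + 3 ≤ n_kit` (`hnS`, `hexRaw`). [folklore] -/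
theorem QK_facts {V : Type} (t : V) (D : Skelφ.StepI.DataNS V) (mk : ℕ) (c : V) : (QK t D mk (V := V)).nS c = nKit D mk ∧ (QK t D mk (V := V)).hS c = hKit t D mk ∧ (QK t D mk (V := V)).ℓS c = ℓKit t D mk ∧
    (QK t D mk (V := V)).RS c = RK t D mk ∧ (QK t D mk (V := V)).vS c = vKit t D mk ∧ 1 ≤ (QK t D mk (V := V)).nS c ∧ Mu D + 3 ≤ (QK t D mk (V := V)).nS c := by
  refine ⟨rfl, rfl, rfl, rfl, rfl, ?_, (nKit_facts D mk).2.2.2.1⟩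
  show 1 ≤ nKit D mk
  have := (nKit_facts D mk).2.1; omega

/-- **The first kit level** `j₀ := T₀` (every level box is then `≥ 2T₀` wide). [this work] -/
def j₀A {V : Type} (t : V) (D : Skelφ.StepI.DataNS V) (mk : ℕ) : ℕ := T₀a t D mk

/-- **The level boxes are wide enough from `j₀` on**: `j₀ ≤ j → 2·T₀ ≤ 2j ∧ d + 2 ≤ 2j ∧ D_sh + 1 + d + KCmax + Rs ≤ 2j` (the `hwide/hdw/hDw` margins for a core
`lo ≤ hi` enlarged by `j` on both sides). [folklore] -/
theorem levels_wide {V : Type} (t : V) (D : Skelφ.StepI.DataNS V) (mk : ℕ) {j : ℕ} (hj : j₀A t D mk ≤ j) : 2 * T₀a t D mk ≤ 2 * j ∧ da t D mk + 2 ≤ 2 * j ∧ Dsh t D mk + 1 + da t D mk + KCmax t D mk + Rs t D mk ≤ 2 * j := by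
  unfold j₀A at hj
  refine ⟨by omega, ?_, ?_⟩
  · have := (le_T₀a t D mk).2.1; unfold da; omega
  · have h1 : Dsh t D mk + KCmax t D mk + Rs t D mk ≤ T₀a t D mk := by unfold T₀a Ma; omega
    have h2 : 1 + da t D mk ≤ T₀a t D mk := by unfold T₀a Dsh da; omega
    omega

/-- **The late near/far threshold** `r₀A Rl := max base (Rl + reach)` for a long-prism radius `Rl` (`:= D.R (D.scale t M_L n_L)` at the slot values). [this work] -/
def r₀A {V : Type} {G : SimpleGraph V} [G.LocallyFinite] (Φ : PlanarSkeletonFrmFrom G) (t : V) (D : Skelφ.StepI.DataNS V) (mk : ℕ) (Rl : ℕ) : ℕ := max (baseA Φ t D mk) (Rl + reachA t D mk)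

/-- `base ≤ r₀A Rl` and `Rl + reach ≤ r₀A Rl` (so `hr₀_apron`/`hreach_apron` apply with `r := Rl`). [folklore] -/
theorem r₀A_ge {V : Type} {G : SimpleGraph V} [G.LocallyFinite] (Φ : PlanarSkeletonFrmFrom G) (t : V) (D : Skelφ.StepI.DataNS V) (mk : ℕ) (Rl : ℕ) : baseA Φ t D mk ≤ r₀A Φ t D mk Rl ∧ Rl + reachA t D mk ≤ r₀A Φ t D mk Rl := ⟨le_max_left _ _, le_max_right _ _⟩

end Skel

/-! ## §4 The counts, the levels, `Rlev` and `R′` -/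

section Counts

/-- **The number of seeds** `kk := kitK Δ sB B δkit p`. [this work] -/
def kkA (κ : Consts) {V : Type} [Countable V] {G : SimpleGraph V} [G.LocallyFinite] (Φ : PlanarSkeletonFrmFrom G) (t : V) (p : unitInterval) (D : Skelφ.StepI.DataNS V) (mk : ℕ) : ℕ := kitK Φ.Δ (sBA Φ t D mk) (BA Φ t D mk) (Neg.δkit κ Φ) p

/-- **The number of contacts** `Nk := kitN Δ sB B δkit p` (`= kk·B`). [this work] -/
def NkA (κ : Consts) {V : Type} [Countable V] {G : SimpleGraph V} [G.LocallyFinite] (Φ : PlanarSkeletonFrmFrom G) (t : V) (p : unitInterval) (D : Skelφ.StepI.DataNS V) (mk : ℕ) : ℕ := kitN Φ.Δ (sBA Φ t D mk) (BA Φ t D mk) (Neg.δkit κ Φ) p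

/-- **The number of levels** `Lcnt := kitL Δ sB B δkit p` (`≥ 1`). [this work] -/
def LcntA (κ : Consts) {V : Type} [Countable V] {G : SimpleGraph V} [G.LocallyFinite] (Φ : PlanarSkeletonFrmFrom G) (t : V) (p : unitInterval) (D : Skelφ.StepI.DataNS V) (mk : ℕ) : ℕ := kitL Φ.Δ (sBA Φ t D mk) (BA Φ t D mk) (Neg.δkit κ Φ) p

/-- **The last kit level** `j₁ := T₀ + Lcnt − 1` (`card [j₀, j₁] = Lcnt`). [this work] -/
def j₁A (κ : Consts) {V : Type} [Countable V] {G : SimpleGraph V} [G.LocallyFinite] (Φ : PlanarSkeletonFrmFrom G) (t : V) (p : unitInterval) (D : Skelφ.StepI.DataNS V) (mk : ℕ) : ℕ := T₀a t D mk + LcntA κ Φ t p D mk - 1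

/-- **THE WINDOW DEPTH IN LEVELS OF RECORD** `Rlev := j₁ + reach` (levels + the kit reach beyond the level). [this work] -/
def RlevA (κ : Consts) {V : Type} [Countable V] {G : SimpleGraph V} [G.LocallyFinite] (Φ : PlanarSkeletonFrmFrom G) (t : V) (p : unitInterval) (D : Skelφ.StepI.DataNS V) (mk : ℕ) : ℕ := j₁A κ Φ t p D mk + reachA t D mk

/-- **THE KIT-LEVEL DISPLACEMENT OF RECORD** `R′ := Rlev + 1` — the ledger's `R′` (v0.11): run enlargement `S.R′`, (C)'s `e − z`, the bridge clearance `Δ₀ = k + 2R′ + 1`,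
the cell floors `s_i ≥ c·R′ + …` (through the box slot `g ∋ 4K(R′+2)`). [cite: KozmaNitzan2024, §4 Theorem 6 (pp. 25–31)] -/
def RA' (κ : Consts) {V : Type} [Countable V] {G : SimpleGraph V} [G.LocallyFinite] (Φ : PlanarSkeletonFrmFrom G) (t : V) (p : unitInterval) (D : Skelφ.StepI.DataNS V) (mk : ℕ) : ℕ := RlevA κ Φ t p D mk + 1

/-- `0 < Lcnt` (under `0 < p < 1`). [folklore] -/
theorem LcntA_pos (κ : Consts) {V : Type} [Countable V] {G : SimpleGraph V} [G.LocallyFinite] (Φ : PlanarSkeletonFrmFrom G) (t : V) (p : unitInterval) (D : Skelφ.StepI.DataNS V) (mk : ℕ) (hp0 : 0 < (p : ℝ)) (hp1 : (p : ℝ) < 1) : 0 < LcntA κ Φ t p D mk := BoxProdZ2.kitL_pos _ _ _ (Neg.δkit_pos κ Φ) p hp0 hp1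

/-- **`card [j₀, j₁] = Lcnt`** (under `0 < p < 1`). [folklore] -/
theorem card_levels (κ : Consts) {V : Type} [Countable V] {G : SimpleGraph V} [G.LocallyFinite] (Φ : PlanarSkeletonFrmFrom G) (t : V) (p : unitInterval) (D : Skelφ.StepI.DataNS V) (mk : ℕ) (hp0 : 0 < (p : ℝ)) (hp1 : (p : ℝ) < 1) : (Finset.Icc (j₀A t D mk) (j₁A κ Φ t p D mk)).card = LcntA κ Φ t p D mk := by
  have := LcntA_pos κ Φ t p D mk hp0 hp1
  rw [Nat.card_Icc]; unfold j₁A j₀A; omega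

/-- `j₀ ≤ j₁` (under `0 < p < 1`). [folklore] -/
theorem j₀A_le_j₁A (κ : Consts) {V : Type} [Countable V] {G : SimpleGraph V} [G.LocallyFinite] (Φ : PlanarSkeletonFrmFrom G) (t : V) (p : unitInterval) (D : Skelφ.StepI.DataNS V) (mk : ℕ) (hp0 : 0 < (p : ℝ)) (hp1 : (p : ℝ) < 1) : j₀A t D mk ≤ j₁A κ Φ t p D mk := by
  have := LcntA_pos κ Φ t p D mk hp0 hp1; unfold j₁A j₀A; omega

/-- **`kk·(Δ+1)^{2rs} ≤ Nk`** (the `hN` hypothesis; under `0 < p < 1`). [folklore] -/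
theorem hNk_at (κ : Consts) {V : Type} [Countable V] {G : SimpleGraph V} [G.LocallyFinite] (Φ : PlanarSkeletonFrmFrom G) (t : V) (p : unitInterval) (D : Skelφ.StepI.DataNS V) (mk : ℕ) (hp0 : 0 < (p : ℝ)) (hp1 : (p : ℝ) < 1) : kkA κ Φ t p D mk * (Φ.Δ + 1) ^ (2 * rsA Φ t D mk) ≤ NkA κ Φ t p D mk :=
  BoxProdZ2.kitK_mul_le_kitN _ _ _ (Neg.δkit_pos κ Φ) p hp0 hp1

/-- **THE COUNTS AT EVERY RUNNING DENSITY `q ∈ [p/2, p]` AND EVERY ACCURACY `δ' ≥ δkit`** (`δ' ∈ {κ.δ, κ.δ₂, κ.δr n}` by `Neg.δkit_le_δ/δ₂/δr`): `(1 − q^{sB})^{kk} ≤ δ'`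
(`hk`) and `1/(1−q)^{Δ·Nk} ≤ δ'·Lcnt` (`hcount` on `[j₀, j₁]`). [cite: KozmaNitzan2024, §4 Lemma 10 Steps II–III (pp. 18–19)] -/
theorem counts_atq (κ : Consts) {V : Type} [Countable V] {G : SimpleGraph V} [G.LocallyFinite] (Φ : PlanarSkeletonFrmFrom G) (t : V) (p : unitInterval) (D : Skelφ.StepI.DataNS V) (mk : ℕ) (hp0 : 0 < (p : ℝ)) (hp1 : (p : ℝ) < 1) {q : unitInterval} (hq1 : (p : ℝ) / 2 ≤ q) (hq2 : (q : ℝ) ≤ p) {δ' : ℝ}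
    (hδ' : Neg.δkit κ Φ ≤ δ') :
    (1 - (q : ℝ) ^ (1 + Φ.Δ * cSA Φ t D mk + cSA Φ t D mk * cUA Φ t D mk)) ^ kkA κ Φ t p D mk ≤ δ' ∧
      1 / (1 - (q : ℝ)) ^ (Φ.Δ * NkA κ Φ t p D mk) ≤ δ' * ((Finset.Icc (j₀A t D mk) (j₁A κ Φ t p D mk)).card : ℝ) := by
  obtain ⟨hk, hc⟩ := BoxProdZ2.kit_counts_at_le Φ.Δ (sBA Φ t D mk) (BA Φ t D mk) (Neg.δkit_pos κ Φ) hδ' p hp0 hp1 hq1 hq2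
  rw [card_levels κ Φ t p D mk hp0 hp1]
  exact ⟨hk, hc _ le_rfl⟩

/-- **The reach fits under `Rlev`**: `j ≤ j₁ → j + reach ≤ Rlev` (so `hE : j + reach ≤ S.R′` holds for every frame with `S.R′ ≥ Rlev`). [folklore] -/
theorem j_reach_le (κ : Consts) {V : Type} [Countable V] {G : SimpleGraph V} [G.LocallyFinite] (Φ : PlanarSkeletonFrmFrom G) (t : V) (p : unitInterval) (D : Skelφ.StepI.DataNS V) (mk : ℕ) {j : ℕ} (hj : j ≤ j₁A κ Φ t p D mk) : j + reachA t D mk ≤ RlevA κ Φ t p D mk := by unfold RlevA; omega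

/-- `R′ = j₁ + reach + 1`, `Rlev + 1 = R′`, `j₁ ≤ Rlev`, `T₀ ≤ j₁` (under `0 < p < 1` for the last). [folklore] -/
theorem RA'_eq (κ : Consts) {V : Type} [Countable V] {G : SimpleGraph V} [G.LocallyFinite] (Φ : PlanarSkeletonFrmFrom G) (t : V) (p : unitInterval) (D : Skelφ.StepI.DataNS V) (mk : ℕ) : RA' κ Φ t p D mk = j₁A κ Φ t p D mk + reachA t D mk + 1 ∧ RlevA κ Φ t p D mk + 1 = RA' κ Φ t p D mk ∧ j₁A κ Φ t p D mk ≤ RlevA κ Φ t p D mk :=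
  ⟨rfl, rfl, Nat.le_add_right _ _⟩

/-- `T₀ < R′`, `Rs + 2 < R′`, `reach < R′`, `1 ≤ R′`. [folklore] -/
theorem T₀a_lt_RA' (κ : Consts) {V : Type} [Countable V] {G : SimpleGraph V} [G.LocallyFinite] (Φ : PlanarSkeletonFrmFrom G) (t : V) (p : unitInterval) (D : Skelφ.StepI.DataNS V) (mk : ℕ) : T₀a t D mk < RA' κ Φ t p D mk ∧ Rs t D mk + 2 < RA' κ Φ t p D mk ∧ reachA t D mk < RA' κ Φ t p D mk ∧ 1 ≤ RA' κ Φ t p D mk := by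
  have h1 : 13 * (T₀a t D mk + 1) ≤ reachA t D mk := by unfold reachA; omega
  have h2 := (le_T₀a t D mk).2.1
  unfold RA' RlevA; omega

end Counts

end KS

end NegB

end PlanarSkeletonFrmFrom

end Summit.CriticalPhenomena.PercolationContinuityZ3.Theorems.Transplant

end
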